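import Literature.NumberTheory.Transcendental.AyoubRelativeAlgebraicity

/-!
# Ayoub's relative Kontsevich–Zagier theorem (revisited) — §1.4 "Une reformulation": the central coefficient and Corollaire 1.15

Sibling of `Literature/NumberTheory/Transcendental/AyoubRelative.lean` (objects `O k = 𝒪 =
𝒪(𝔸^∞ × 𝔼^∞) = k[z, t, t⁻¹]`, `intO = ∫`, `dz i`, `restr i c`, `euler j`, `relA i`, `mapCoeff`,
`intLaurent`, `Odagger k = 𝒪†_alg`, `ayoubGenerators k`, the NAMED FACT
`Literature.NumberTheory.Transcendental.AyoubRel.ayoub_relativeKZ_revisited` = Théorème 1.7) and of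
`AyoubRelativeAlgebraicity.lean` (`𝒪†_alg` is a subalgebra stable under the operators).
Source: J. Ayoub, *La version relative de la conjecture des périodes de Kontsevich–Zagier
revisitée*, Tohoku Math. J. (2) 71 (2019) 465–485 (preprint `rel-KZ-bis`, Univ. Zürich), §1.4:

* the **central coefficient** (7) `cc : 𝒪(𝔸^∞ × 𝔼^∞) → 𝒪(𝔸^∞)`, `cc(f)` = the coefficient of the
  monomial `t^0` in `f`, with `∫ f = ∫_{[0,1]^∞} cc(f)` (Lemme 1.5); applied term by term it gives
  (8) `cc : 𝒪†_alg(𝔸^∞ × 𝔼^∞) → 𝒪(𝔸^∞)[[ϖ]][ϖ⁻¹]`, whose IMAGE is denoted `𝒪†_{cent-alg}(𝔸^∞)`;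
  "clairement, `𝒪†_{cent-alg}(𝔸^∞)` contient `𝒪†_alg(𝔸^∞)` et il est stable par la dérivation par
  rapport aux indéterminées `zᵢ` et par leurs substitutions par `0` ou `1`";
* **Corollaire 1.15** ("conséquence immédiate du Théorème 1.7"): the kernel of term-by-term
  integration (9) `∫ : 𝒪†_{cent-alg}(𝔸^∞) → k((ϖ))` is the `k`-subspace spanned by the
  `∂G/∂zᵢ - G|_{zᵢ=1} + G|_{zᵢ=0}`, `G ∈ 𝒪†_{cent-alg}(𝔸^∞)`. Its printed proof: `cc` is onto by
  construction, kills the type (b) generators `tⱼ ∂H/∂tⱼ` of Théorème 1.7 and commutes with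
  `∂/∂zᵢ` and `(·)|_{zᵢ=ε}`.

SIGN MISPRINT. The preprint prints the generator of Corollaire 1.15 as
`∂G/∂zᵢ - G|_{zᵢ=1} - G|_{zᵢ=0}`; with this sign the statement is false (`G = 1` gives the
element `-2`, whose integral is `-2 ≠ 0`), and the printed proof (transporting the type (a)
generators of Théorème 1.7 along `cc`) yields `+ G|_{zᵢ=0}`. We vend the corrected sign, i.e. the
same operator `relA i = ∂/∂zᵢ - (·)|_{zᵢ=1} + (·)|_{zᵢ=0}` as in Théorème 1.7 (a).

## Lean rendering

* `cc k : O k →ₗ[k] O k`, `z^a t^b ↦ [b = 0] z^a`: we identify `𝒪(𝔸^∞) = k[z]` with the `t`-free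
  part of `𝒪 = k[z, t, t⁻¹]` (the paper's (7) followed by the inclusion `𝒪(𝔸^∞) ⊂ 𝒪(𝔸^∞ × 𝔼^∞)`),
  so that the operators `∂/∂zᵢ`, `(·)|_{zᵢ=c}` and `∫` of `AyoubRelative.lean` apply verbatim;
  `cc` is an idempotent (`cc_comp_cc`) with `∫ ∘ cc = ∫` (`intO_comp_cc`, Lemme 1.5).
* `OdaggerCent k = 𝒪†_{cent-alg}(𝔸^∞) := (mapCoeff cc) '' 𝒪†_alg` — the image of (8), as printed
  (by Exemple 1.16 it is NOT contained in `𝒪†_alg`).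
* `centGenerators k` = the generators of Corollaire 1.15 (corrected sign).
* Proved: `cc` kills `tⱼ∂/∂tⱼ` and commutes with `∂/∂zᵢ`, `(·)|_{zᵢ=c}`, `relA i`
  (`cc_comp_euler/dz/restr/relA`); `𝒪†_{cent-alg}` is a subspace stable under `∂/∂zᵢ`,
  `(·)|_{zᵢ=c}`, `relA i` and contains the `t`-free elements of `𝒪†_alg`; the easy inclusion
  `span ⊆ ker` of Corollaire 1.15 unconditionally (`span_centGenerators_le_ker`); and
  **Corollaire 1.15 from the named fact** (`ayoub_relativeKZ_revisited.central`, printed set form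
  `ayoub_relativeKZ_revisited.central_ker_eq_span`).

## References

* J. Ayoub, *La version relative de la conjecture des périodes de Kontsevich–Zagier revisitée*,
  Tohoku Math. J. (2) 71 (2019), no. 3, 465–485, doi:10.2748/tmj/1568772181: §1.4 (7), (8), (9),
  Corollaire 1.15, Exemple 1.16, Remarque 1.17 (bib key `AyoubRelKZRevisited`).
-/

noncomputable section

open Finsupp

namespace Literature.NumberTheory.Transcendental.AyoubRel

variable (k : Type) [Field k]

/-! ### The central coefficient -/

/-- **The central coefficient** `cc` (the morphism (7) of the note): `cc(f)` is the coefficient of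
the monomial `t^0` in `f ∈ 𝒪(𝔸^∞ × 𝔼^∞) = k[z, t, t⁻¹]`, a polynomial in `z` alone; here
`𝒪(𝔸^∞) = k[z]` is identified with the `t`-free part of `𝒪`, so `cc : z^a t^b ↦ [b = 0] · z^a` is a
`k`-linear idempotent of `𝒪`. [Ayoub, revisited note, §1.4 (7)] [cite: AyoubRelKZRevisited, §1.4 (7)] -/
def cc : O k →ₗ[k] O k :=
  (Finsupp.linearCombination k fun m : Mono => if m.2 = 0 then mono k m else 0) ∘ₗ
    (AddMonoidAlgebra.coeffLinearEquiv k).toLinearMap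

/-- **`𝒪†_{cent-alg}(𝔸^∞)`**: the image of `𝒪†_alg(𝔸^∞ × 𝔼^∞)` under the term-by-term central
coefficient (8) `cc : 𝒪†_alg(𝔸^∞ × 𝔼^∞) → 𝒪(𝔸^∞)[[ϖ]][ϖ⁻¹]`. (It is not contained in `𝒪†_alg`:
Exemple 1.16 of the note.) [Ayoub, revisited note, §1.4 (8)] [cite: AyoubRelKZRevisited, §1.4 (8)] -/
def OdaggerCent : Set (LaurentSeries (O k)) :=
  mapCoeff k (cc k) '' Odagger k

/-- The generators of Corollaire 1.15: `∂G/∂zᵢ - G|_{zᵢ=1} + G|_{zᵢ=0}` (coefficientwise in `ϖ`)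
for `G ∈ 𝒪†_{cent-alg}(𝔸^∞)` and `i` a variable index (the preprint prints `- G|_{zᵢ=0}`, a sign
misprint: see the module docstring). [Ayoub, revisited note, Corollaire 1.15]
[cite: AyoubRelKZRevisited, Corollaire 1.15] -/
def centGenerators : Set (LaurentSeries (O k)) :=
  {x | ∃ G ∈ OdaggerCent k, ∃ i : ℕ, x = mapCoeff k (relA k i) G}

variable {k}

/-- `cc` on a monomial: `cc (z^a t^b) = [b = 0] · z^a t^b`. [Ayoub, revisited note, §1.4 (7)]
[folklore] -/
theorem cc_mono (a : ℕ →₀ ℕ) (b : ℕ →₀ ℤ) :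
    cc k (mono k (a, b)) = if b = 0 then mono k (a, b) else 0 := by
  simp [cc, mono, AddMonoidAlgebra.coeff_single, Finsupp.linearCombination_single]

/-- `cc` fixes the `t`-free monomials. [folklore] -/
theorem cc_mono_zero (a : ℕ →₀ ℕ) : cc k (mono k (a, 0)) = mono k (a, 0) := by
  rw [cc_mono, if_pos rfl]

/-- `cc` kills the monomials with a non-trivial `t`-part. [folklore] -/
theorem cc_mono_of_ne_zero (a : ℕ →₀ ℕ) {b : ℕ →₀ ℤ} (hb : b ≠ 0) : cc k (mono k (a, b)) = 0 := by
  rw [cc_mono, if_neg hb]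

/-- `cc(f)` IS the coefficient of `t^0`: the coefficient function of `cc f` is that of `f`
restricted to the `t`-free monomials `z^a t^0`. [Ayoub, revisited note, §1.4 (7)] [folklore] -/
theorem coeff_cc (f : O k) : (cc k f).coeff = f.coeff.filter fun m : Mono => m.2 = 0 := by
  induction f using AddMonoidAlgebra.induction_linear with
  | zero => rw [map_zero, AddMonoidAlgebra.coeff_zero, Finsupp.filter_zero]
  | add x y hx hy =>
    rw [map_add, AddMonoidAlgebra.coeff_add, hx, hy, AddMonoidAlgebra.coeff_add, Finsupp.filter_add]
  | single m r =>
    obtain ⟨a, b⟩ := m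
    have hs : (AddMonoidAlgebra.single (a, b) r : O k) = r • mono k (a, b) := by
      rw [mono, AddMonoidAlgebra.smul_single, smul_eq_mul, mul_one]
    rw [hs, map_smul, AddMonoidAlgebra.coeff_smul, AddMonoidAlgebra.coeff_smul, Finsupp.filter_smul]
    by_cases hb : b = 0
    · subst hb
      rw [cc_mono_zero, mono, AddMonoidAlgebra.coeff_single, Finsupp.filter_single_of_pos]
      rfl
    · rw [cc_mono_of_ne_zero a hb, mono, AddMonoidAlgebra.coeff_single,
        Finsupp.filter_single_of_neg, AddMonoidAlgebra.coeff_zero, smul_zero]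
      exact hb

/-- Linear maps out of `𝒪` are determined by their values on monomials. [folklore] -/
theorem linearMap_ext_mono {W : Type} [AddCommGroup W] [Module k W] {f g : O k →ₗ[k] W}
    (h : ∀ m : Mono, f (mono k m) = g (mono k m)) : f = g :=
  (AddMonoidAlgebra.basis Mono k).ext fun m => by
    simpa only [AddMonoidAlgebra.basis_apply, mono] using h m

/-- `cc` is idempotent (a projector onto the `t`-free part `𝒪(𝔸^∞) ⊂ 𝒪`). [folklore] -/
theorem cc_comp_cc : cc k ∘ₗ cc k = cc k :=
  linearMap_ext_mono fun m => by
    obtain ⟨a, b⟩ := m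
    rw [LinearMap.comp_apply]
    by_cases hb : b = 0
    · subst hb; rw [cc_mono_zero, cc_mono_zero]
    · rw [cc_mono_of_ne_zero a hb, map_zero]

/-- **`∫ f = ∫_{[0,1]^∞} cc(f)`** (Lemme 1.5): integration factors through the central coefficient.
[Ayoub, revisited note, Lemme 1.5 and §1.4] [cite: AyoubRelKZRevisited, Lemme 1.5] -/
theorem intO_comp_cc : intO k ∘ₗ cc k = intO k :=
  linearMap_ext_mono fun m => by
    obtain ⟨a, b⟩ := m
    rw [LinearMap.comp_apply]
    by_cases hb : b = 0
    · subst hb; rw [cc_mono_zero]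
    · rw [cc_mono_of_ne_zero a hb, map_zero, intO_mono, monoWeight_of_ne_zero (k := k) a hb]

/-- Pointwise form of `intO_comp_cc`. [Ayoub, revisited note, Lemme 1.5] [folklore] -/
theorem intO_cc (f : O k) : intO k (cc k f) = intO k f :=
  LinearMap.congr_fun intO_comp_cc f

/-- **`cc` kills the type (b) generators**: `cc ∘ (tⱼ ∂/∂tⱼ) = 0` (`tⱼ∂/∂tⱼ` multiplies `z^a t^b`
by `bⱼ`, which vanishes when `b = 0`). [Ayoub, revisited note, proof of Corollaire 1.15]
[folklore] -/
theorem cc_comp_euler (j : ℕ) : cc k ∘ₗ euler k j = 0 :=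
  linearMap_ext_mono fun m => by
    obtain ⟨a, b⟩ := m
    rw [LinearMap.comp_apply, euler_mono, map_smul, LinearMap.zero_apply]
    by_cases hb : b = 0
    · subst hb; simp
    · rw [cc_mono_of_ne_zero a hb, smul_zero]

/-- **`cc` commutes with `∂/∂zᵢ`.** [Ayoub, revisited note, proof of Corollaire 1.15] [folklore] -/
theorem cc_comp_dz (i : ℕ) : cc k ∘ₗ dz k i = dz k i ∘ₗ cc k :=
  linearMap_ext_mono fun m => by
    obtain ⟨a, b⟩ := m
    rw [LinearMap.comp_apply, LinearMap.comp_apply, dz_mono, map_smul]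
    by_cases hb : b = 0
    · subst hb
      exact (congrArg _ (cc_mono_zero _)).trans
        ((dz_mono i _).symm.trans (congrArg _ (cc_mono_zero _).symm))
    · rw [cc_mono_of_ne_zero a hb, map_zero]
      exact (congrArg _ (cc_mono_of_ne_zero _ hb)).trans (smul_zero _)

/-- **`cc` commutes with the substitutions `zᵢ = c`.** [Ayoub, revisited note, proof of
Corollaire 1.15] [folklore] -/
theorem cc_comp_restr (i : ℕ) (c : k) : cc k ∘ₗ restr k i c = restr k i c ∘ₗ cc k :=
  linearMap_ext_mono fun m => by
    obtain ⟨a, b⟩ := m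
    rw [LinearMap.comp_apply, LinearMap.comp_apply, restr_mono, map_smul]
    by_cases hb : b = 0
    · subst hb
      exact (congrArg _ (cc_mono_zero _)).trans
        ((restr_mono i c _).symm.trans (congrArg _ (cc_mono_zero _).symm))
    · rw [cc_mono_of_ne_zero a hb, map_zero]
      exact (congrArg _ (cc_mono_of_ne_zero _ hb)).trans (smul_zero _)

/-- **`cc` commutes with the type (a) operator** `∂/∂zᵢ - (·)|_{zᵢ=1} + (·)|_{zᵢ=0}`.
[Ayoub, revisited note, proof of Corollaire 1.15] [folklore] -/
theorem cc_comp_relA (i : ℕ) : cc k ∘ₗ relA k i = relA k i ∘ₗ cc k := by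
  simp only [relA, LinearMap.comp_add, LinearMap.comp_sub, LinearMap.add_comp, LinearMap.sub_comp,
    cc_comp_dz, cc_comp_restr]

/-! ### The term-by-term central coefficient (8) -/

/-- (8) commutes with the coefficientwise `∂/∂zᵢ`. [Ayoub, revisited note, §1.4] [folklore] -/
theorem mapCoeff_cc_mapCoeff_dz (i : ℕ) (G : LaurentSeries (O k)) :
    mapCoeff k (cc k) (mapCoeff k (dz k i) G) = mapCoeff k (dz k i) (mapCoeff k (cc k) G) := by
  rw [mapCoeff_mapCoeff, mapCoeff_mapCoeff, cc_comp_dz]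

/-- (8) commutes with the coefficientwise substitution `zᵢ = c`. [Ayoub, revisited note, §1.4]
[folklore] -/
theorem mapCoeff_cc_mapCoeff_restr (i : ℕ) (c : k) (G : LaurentSeries (O k)) :
    mapCoeff k (cc k) (mapCoeff k (restr k i c) G) =
      mapCoeff k (restr k i c) (mapCoeff k (cc k) G) := by
  rw [mapCoeff_mapCoeff, mapCoeff_mapCoeff, cc_comp_restr]

/-- (8) maps a type (a) generator of Théorème 1.7 to a generator of Corollaire 1.15.
[Ayoub, revisited note, proof of Corollaire 1.15] [folklore] -/
theorem mapCoeff_cc_mapCoeff_relA (i : ℕ) (G : LaurentSeries (O k)) :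
    mapCoeff k (cc k) (mapCoeff k (relA k i) G) = mapCoeff k (relA k i) (mapCoeff k (cc k) G) := by
  rw [mapCoeff_mapCoeff, mapCoeff_mapCoeff, cc_comp_relA]

/-- (8) kills the type (b) generators of Théorème 1.7. [Ayoub, revisited note, proof of
Corollaire 1.15] [folklore] -/
theorem mapCoeff_cc_mapCoeff_euler (j : ℕ) (H : LaurentSeries (O k)) :
    mapCoeff k (cc k) (mapCoeff k (euler k j) H) = 0 := by
  rw [mapCoeff_mapCoeff, cc_comp_euler, mapCoeff_zero]

/-- **The commutative triangle of Corollaire 1.15**: `∫ ∘ cc = ∫` term by term, i.e. the maps (5)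
and (9) ∘ (8) agree. [Ayoub, revisited note, proof of Corollaire 1.15]
[cite: AyoubRelKZRevisited, Corollaire 1.15] -/
theorem intLaurent_mapCoeff_cc (F : LaurentSeries (O k)) :
    intLaurent k (mapCoeff k (cc k) F) = intLaurent k F := by
  rw [intLaurent, mapCoeff_mapCoeff, intO_comp_cc]

/-! ### `𝒪†_{cent-alg}(𝔸^∞)` -/

/-- Membership in `𝒪†_{cent-alg}(𝔸^∞)`, unfolded: the image of (8). [Ayoub, revisited note, §1.4]
[cite: AyoubRelKZRevisited, §1.4 (8)] -/
theorem mem_odaggerCent_iff (F : LaurentSeries (O k)) :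
    F ∈ OdaggerCent k ↔ ∃ F₀ ∈ Odagger k, mapCoeff k (cc k) F₀ = F :=
  Iff.rfl

/-- (8) lands in `𝒪†_{cent-alg}(𝔸^∞)` (by definition). [Ayoub, revisited note, §1.4] [folklore] -/
theorem mapCoeff_cc_mem_odaggerCent {F : LaurentSeries (O k)} (hF : F ∈ Odagger k) :
    mapCoeff k (cc k) F ∈ OdaggerCent k :=
  ⟨F, hF, rfl⟩

/-- `𝒪†_{cent-alg}(𝔸^∞)` is (the carrier of) a `k`-subspace of `𝒪((ϖ))` (image of the subspace
`𝒪†_alg` under a linear map). [Ayoub, revisited note, §1.4] [folklore] -/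
theorem exists_submodule_coe_eq_odaggerCent :
    ∃ S : Submodule k (LaurentSeries (O k)), (S : Set (LaurentSeries (O k))) = OdaggerCent k := by
  obtain ⟨S, hS⟩ := exists_submodule_coe_eq_odagger (k := k)
  exact ⟨S.map (mapCoeff k (cc k)), by rw [Submodule.map_coe, hS]; rfl⟩

/-- **`𝒪†_{cent-alg}(𝔸^∞)` contains the `t`-free algebraic Laurent series** (in particular
`𝒪†_alg(𝔸^∞)`, the note's "contient `𝒪†_alg(𝔸^∞)`"): an element of `𝒪†_alg` fixed by (8) is its
own central coefficient. [Ayoub, revisited note, §1.4] [folklore] -/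
theorem mem_odaggerCent_of_mapCoeff_cc_eq {F : LaurentSeries (O k)} (hF : F ∈ Odagger k)
    (h : mapCoeff k (cc k) F = F) : F ∈ OdaggerCent k :=
  ⟨F, hF, h⟩

/-- **`𝒪†_{cent-alg}(𝔸^∞)` is stable under `∂/∂zᵢ`** ("stable par la dérivation par rapport aux
indéterminées `zᵢ`"). [Ayoub, revisited note, §1.4] [cite: AyoubRelKZRevisited, §1.4] -/
theorem mapCoeff_dz_mem_odaggerCent [CharZero k] (i : ℕ) {F : LaurentSeries (O k)}
    (hF : F ∈ OdaggerCent k) : mapCoeff k (dz k i) F ∈ OdaggerCent k := by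
  obtain ⟨F₀, hF₀, rfl⟩ := hF
  exact ⟨mapCoeff k (dz k i) F₀, mapCoeff_mem_odagger_of_leibniz _ (dz_mul i) hF₀,
    mapCoeff_cc_mapCoeff_dz i F₀⟩

/-- **`𝒪†_{cent-alg}(𝔸^∞)` is stable under the substitutions `zᵢ = c`** (the note: "par leurs
substitutions par `0` ou `1`"). [Ayoub, revisited note, §1.4] [cite: AyoubRelKZRevisited, §1.4] -/
theorem mapCoeff_restr_mem_odaggerCent (i : ℕ) (c : k) {F : LaurentSeries (O k)}
    (hF : F ∈ OdaggerCent k) : mapCoeff k (restr k i c) F ∈ OdaggerCent k := by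
  obtain ⟨F₀, hF₀, rfl⟩ := hF
  exact ⟨mapCoeff k (restr k i c) F₀, mapCoeff_restr_mem_odagger i c hF₀,
    mapCoeff_cc_mapCoeff_restr i c F₀⟩

/-- `𝒪†_{cent-alg}(𝔸^∞)` is stable under the type (a) operator `∂/∂zᵢ - (·)|_{zᵢ=1} + (·)|_{zᵢ=0}`.
[Ayoub, revisited note, §1.4] [folklore] -/
theorem mapCoeff_relA_mem_odaggerCent [CharZero k] (i : ℕ) {F : LaurentSeries (O k)}
    (hF : F ∈ OdaggerCent k) : mapCoeff k (relA k i) F ∈ OdaggerCent k := by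
  obtain ⟨F₀, hF₀, rfl⟩ := hF
  exact ⟨mapCoeff k (relA k i) F₀, mapCoeff_relA_mem_odagger i hF₀, mapCoeff_cc_mapCoeff_relA i F₀⟩

/-- The generators of Corollaire 1.15 lie in `𝒪†_{cent-alg}(𝔸^∞)`. [Ayoub, revisited note,
Corollaire 1.15] [folklore] -/
theorem centGenerators_subset_odaggerCent [CharZero k] : centGenerators k ⊆ OdaggerCent k := by
  rintro x ⟨G, hG, i, rfl⟩
  exact mapCoeff_relA_mem_odaggerCent i hG

/-- … hence so does their `k`-span. [Ayoub, revisited note, Corollaire 1.15] [folklore] -/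
theorem span_centGenerators_subset_odaggerCent [CharZero k] :
    (Submodule.span k (centGenerators k) : Set (LaurentSeries (O k))) ⊆ OdaggerCent k := by
  obtain ⟨S, hS⟩ := exists_submodule_coe_eq_odaggerCent (k := k)
  rw [← hS]
  exact Submodule.span_le.mpr (hS.symm ▸ centGenerators_subset_odaggerCent)

/-! ### Corollaire 1.15 -/

/-- **Corollaire 1.15, easy inclusion** (unconditional): the generators, hence their span, are
killed by term-by-term integration. [Ayoub, revisited note, Corollaire 1.15]
[cite: AyoubRelKZRevisited, Corollaire 1.15] -/
theorem span_centGenerators_le_ker [CharZero k] :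
    Submodule.span k (centGenerators k) ≤ LinearMap.ker (intLaurent k) := by
  rw [Submodule.span_le]
  rintro x ⟨G, -, i, rfl⟩
  exact LinearMap.mem_ker.mpr (intLaurent_mapCoeff_relA i G)

/-- (8) maps the span of the generators of Théorème 1.7 into the span of the generators of
Corollaire 1.15 (type (a) ↦ type (a) of `cc G`, type (b) ↦ `0`). [Ayoub, revisited note, proof of
Corollaire 1.15] [folklore] -/
theorem map_span_ayoubGenerators_le :
    (Submodule.span k (ayoubGenerators k)).map (mapCoeff k (cc k)) ≤
      Submodule.span k (centGenerators k) := by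
  rw [Submodule.map_span_le]
  rintro x (⟨G, hG, i, rfl⟩ | ⟨H, -, j, rfl⟩)
  · rw [mapCoeff_cc_mapCoeff_relA]
    exact Submodule.subset_span ⟨_, mapCoeff_cc_mem_odaggerCent hG, i, rfl⟩
  · rw [mapCoeff_cc_mapCoeff_euler]
    exact zero_mem _

/-- **Corollaire 1.15 (from the named fact Théorème 1.7).** For a field `k` of characteristic `0`
embeddable in `ℂ` and `F ∈ 𝒪†_{cent-alg}(𝔸^∞)`: `∫ F = 0` in `k((ϖ))` iff `F` lies in the `k`-span
of the `∂G/∂zᵢ - G|_{zᵢ=1} + G|_{zᵢ=0}`, `G ∈ 𝒪†_{cent-alg}(𝔸^∞)`. Proof as printed: write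
`F = cc F₀` with `F₀ ∈ 𝒪†_alg`; `∫ F₀ = ∫ cc F₀ = 0`, so `F₀` is in the span of the generators of
Théorème 1.7 (the fact), and `cc` maps those to generators of the corollary or to `0`. (Sign of
`G|_{zᵢ=0}` corrected, see the module docstring.) [Ayoub, revisited note, Corollaire 1.15]
[cite: AyoubRelKZRevisited, Corollaire 1.15] -/
theorem ayoub_relativeKZ_revisited.central (h : ayoub_relativeKZ_revisited) (k : Type) [Field k]
    [CharZero k] (hk : Nonempty (k →+* ℂ)) (F : LaurentSeries (O k)) (hF : F ∈ OdaggerCent k) :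
    intLaurent k F = 0 ↔ F ∈ Submodule.span k (centGenerators k) := by
  refine ⟨fun h0 => ?_, fun hs => LinearMap.mem_ker.mp (span_centGenerators_le_ker hs)⟩
  obtain ⟨F₀, hF₀, rfl⟩ := hF
  rw [intLaurent_mapCoeff_cc] at h0
  exact map_span_ayoubGenerators_le (Submodule.mem_map_of_mem ((h k hk F₀ hF₀).mp h0))

/-- **Corollaire 1.15 in its printed form** (from the named fact): "le noyau de (9) est le
sous-`k`-espace vectoriel engendré par …", an equality of subsets of `𝒪((ϖ))` (the span lies in
`𝒪†_{cent-alg}(𝔸^∞)` by `span_centGenerators_subset_odaggerCent`).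
[Ayoub, revisited note, Corollaire 1.15] [cite: AyoubRelKZRevisited, Corollaire 1.15] -/
theorem ayoub_relativeKZ_revisited.central_ker_eq_span (h : ayoub_relativeKZ_revisited)
    (k : Type) [Field k] [CharZero k] (hk : Nonempty (k →+* ℂ)) :
    {F : LaurentSeries (O k) | F ∈ OdaggerCent k ∧ intLaurent k F = 0} =
      Submodule.span k (centGenerators k) := by
  ext F
  refine ⟨fun hF => (h.central k hk F hF.1).mp hF.2, fun hF => ?_⟩
  have hF' : F ∈ OdaggerCent k := span_centGenerators_subset_odaggerCent hF
  exact ⟨hF', (h.central k hk F hF').mpr hF⟩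

end Literature.NumberTheory.Transcendental.AyoubRel
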